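import Mathlib
import HarnessLib

/-!
# Route `SwapVirialDeficit` (YangMills): THE PETER–PAUL BLOCK SPLIT OF A GAUSSIAN INTEGRAL (brick (E3)(iv) of the LEAD's memo10d for `stub_core_end` ∕ `stub_core_tip`
# of skeleton ➎; cell ym-idea-1, LEAD g99 free hands, 2026-08-31)

For a positive-semidefinite symmetric bilinear form `B` on a real vector space `V` and `θ > 0` the cross term obeys `2B(ℓ,f) ≤ θ⁻¹B(ℓ,ℓ) + θB(f,f)`, hence
`(1−θ⁻¹)B(ℓ,ℓ) + (1−θ)B(f,f) ≤ B(ℓ+f, ℓ+f) ≤ (1+θ⁻¹)B(ℓ,ℓ) + (1+θ)B(f,f)` (§1).  Consequently a Gaussian integral over a product of two blocks is bounded BELOW by the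
product of the two block Gaussians with the forms scaled by `(1+θ⁻¹)` and `(1+θ)` (§2, `lintegral` form, any measures, any block maps `ι₁, ι₂` into `V`) — with
`θ = 1/d_F` the follower block loses only `(1+1/d_F)^{−d_F/2} ≥ e^{−1/2}` (§3: `(1 + 1/d)^d ≤ e`), the leader block a polynomial `(1+d_F)^{−d_L/2}`: this is how the
bulk main term's Morse–Bott density is bounded below by the FOLLOWER determinant without Fischer's inequality and without the `2^{−d/2}` of the naive split
(memo10d; HOME `sfw-p2-g99-memo10-24197-endcore-plan.md`).

HONEST LABEL: elementary inequalities; `stub_core_end`, `stub_core_tip`, `stub_B_stiff`, `stub_h001_good`, ⟨24197⟩ ∕ ⟨24194⟩ OPEN; own crux ⟨22884⟩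
`LargeFieldMassRefinementTail` OPEN (blocked-on ⟨19935⟩); the Yang–Mills mass gap is NOT proved; no summit is proved by a line.  No instance, no notation,
no definition, 0 `sorry`, standard axioms.  `--supports stmt-QuantumFields-24197`.
References: [folklore].
-/

set_option autoImplicit false

noncomputable section

open MeasureTheory Set
open scoped ENNReal

namespace Summit.QuantumFields.YangMills.Theorems.SwapVirialDeficit.SectorLaplace

/-! ## §1 The cross term of a positive-semidefinite form -/

variable {V : Type*} [AddCommGroup V] [Module ℝ V]

/-- ★ PETER–PAUL for a symmetric positive-semidefinite bilinear form: `2B(ℓ,f) ≤ θ⁻¹B(ℓ,ℓ) + θB(f,f)` (`θ > 0`). [folklore] -/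
theorem two_mul_cross_le (B : V →ₗ[ℝ] V →ₗ[ℝ] ℝ) (hsym : ∀ v w, B v w = B w v) (hpsd : ∀ v, 0 ≤ B v v) {θ : ℝ} (hθ : 0 < θ) (ℓ f : V) :
    2 * B ℓ f ≤ θ⁻¹ * B ℓ ℓ + θ * B f f := by
  have h := hpsd (θ⁻¹ • ℓ - f)
  have hexp : B (θ⁻¹ • ℓ - f) (θ⁻¹ • ℓ - f) = θ⁻¹ * θ⁻¹ * B ℓ ℓ - 2 * θ⁻¹ * B ℓ f + B f f := by
    simp only [map_sub, map_smul, LinearMap.sub_apply, LinearMap.smul_apply, smul_eq_mul, hsym f ℓ]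
    ring
  rw [hexp] at h
  have hθ' : 0 < θ⁻¹ := inv_pos.2 hθ
  -- multiply by θ > 0
  have h2 : 0 ≤ θ * (θ⁻¹ * θ⁻¹ * B ℓ ℓ - 2 * θ⁻¹ * B ℓ f + B f f) := mul_nonneg hθ.le h
  have hid : θ * (θ⁻¹ * θ⁻¹ * B ℓ ℓ - 2 * θ⁻¹ * B ℓ f + B f f) = θ⁻¹ * B ℓ ℓ - 2 * B ℓ f + θ * B f f := by
    field_simp
  rw [hid] at h2
  linarith

/-- ★ UPPER block split: `B(ℓ+f, ℓ+f) ≤ (1+θ⁻¹)B(ℓ,ℓ) + (1+θ)B(f,f)`. [folklore] -/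
theorem quadForm_add_le (B : V →ₗ[ℝ] V →ₗ[ℝ] ℝ) (hsym : ∀ v w, B v w = B w v) (hpsd : ∀ v, 0 ≤ B v v) {θ : ℝ} (hθ : 0 < θ) (ℓ f : V) :
    B (ℓ + f) (ℓ + f) ≤ (1 + θ⁻¹) * B ℓ ℓ + (1 + θ) * B f f := by
  have h := two_mul_cross_le B hsym hpsd hθ ℓ f
  have hexp : B (ℓ + f) (ℓ + f) = B ℓ ℓ + 2 * B ℓ f + B f f := by
    simp only [map_add, LinearMap.add_apply, hsym f ℓ]; ring
  rw [hexp]; nlinarith [h]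

/-- ★ LOWER block split: `(1−θ⁻¹)B(ℓ,ℓ) + (1−θ)B(f,f) ≤ B(ℓ+f, ℓ+f)`. [folklore] -/
theorem quadForm_add_ge (B : V →ₗ[ℝ] V →ₗ[ℝ] ℝ) (hsym : ∀ v w, B v w = B w v) (hpsd : ∀ v, 0 ≤ B v v) {θ : ℝ} (hθ : 0 < θ) (ℓ f : V) :
    (1 - θ⁻¹) * B ℓ ℓ + (1 - θ) * B f f ≤ B (ℓ + f) (ℓ + f) := by
  have h := two_mul_cross_le B hsym hpsd hθ ℓ (-f)
  have hexp : B (ℓ + f) (ℓ + f) = B ℓ ℓ + 2 * B ℓ f + B f f := by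
    simp only [map_add, LinearMap.add_apply, hsym f ℓ]; ring
  simp only [map_neg, LinearMap.neg_apply, neg_neg, mul_neg] at h
  rw [hexp]; nlinarith [h]

/-! ## §2 The Gaussian integral over two blocks, from below -/

/-- ★★ **BLOCK LOWER BOUND FOR A GAUSSIAN INTEGRAL**: for block maps `ι₁ : E₁ → V`, `ι₂ : E₂ → V` (any functions), σ-finite measures `μ, ν`, a symmetric
positive-semidefinite `B`, `θ > 0` and `c ≥ 0`,
`(∫⁻ e^{−c(1+θ⁻¹)B(ι₁ℓ)²} dμ)·(∫⁻ e^{−c(1+θ)B(ι₂f)²} dν) ≤ ∫⁻ e^{−cB(ι₁ℓ+ι₂f)²} d(μ ⊗ ν)`. [folklore] -/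
theorem lintegral_prod_gaussian_block_ge {E₁ E₂ : Type*} [MeasurableSpace E₁] [MeasurableSpace E₂] (μ : Measure E₁) (ν : Measure E₂) [SFinite ν]
    (B : V →ₗ[ℝ] V →ₗ[ℝ] ℝ) (hsym : ∀ v w, B v w = B w v) (hpsd : ∀ v, 0 ≤ B v v) {θ : ℝ} (hθ : 0 < θ) {c : ℝ} (hc : 0 ≤ c)
    (ι₁ : E₁ → V) (ι₂ : E₂ → V) (h₁ : AEMeasurable (fun ℓ => B (ι₁ ℓ) (ι₁ ℓ)) μ) (h₂ : AEMeasurable (fun f => B (ι₂ f) (ι₂ f)) ν) :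
    (∫⁻ ℓ, ENNReal.ofReal (Real.exp (-(c * ((1 + θ⁻¹) * B (ι₁ ℓ) (ι₁ ℓ))))) ∂μ) *
        (∫⁻ f, ENNReal.ofReal (Real.exp (-(c * ((1 + θ) * B (ι₂ f) (ι₂ f))))) ∂ν) ≤
      ∫⁻ p : E₁ × E₂, ENNReal.ofReal (Real.exp (-(c * B (ι₁ p.1 + ι₂ p.2) (ι₁ p.1 + ι₂ p.2)))) ∂(μ.prod ν) := by
  have hm₁ : AEMeasurable (fun ℓ => ENNReal.ofReal (Real.exp (-(c * ((1 + θ⁻¹) * B (ι₁ ℓ) (ι₁ ℓ)))))) μ :=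
    ENNReal.measurable_ofReal.comp_aemeasurable (Real.measurable_exp.comp_aemeasurable ((h₁.const_mul _).const_mul c).neg)
  have hm₂ : AEMeasurable (fun f => ENNReal.ofReal (Real.exp (-(c * ((1 + θ) * B (ι₂ f) (ι₂ f)))))) ν :=
    ENNReal.measurable_ofReal.comp_aemeasurable (Real.measurable_exp.comp_aemeasurable ((h₂.const_mul _).const_mul c).neg)
  rw [← lintegral_prod_mul hm₁ hm₂]
  refine lintegral_mono fun p => ?_
  rw [← ENNReal.ofReal_mul (Real.exp_pos _).le, ← Real.exp_add]
  refine ENNReal.ofReal_le_ofReal (Real.exp_le_exp.2 ?_)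
  have h := quadForm_add_le B hsym hpsd hθ (ι₁ p.1) (ι₂ p.2)
  nlinarith [h, hc]

/-! ## §3 The follower block loses only `√e` -/

/-- `(1 + 1/d)^d ≤ e` for a natural number `d ≥ 1` (indeed for every `d`). [folklore] -/
theorem one_add_inv_pow_le_exp_one (d : ℕ) : (1 + 1 / (d : ℝ)) ^ d ≤ Real.exp 1 := by
  rcases Nat.eq_zero_or_pos d with hd | hd
  · subst hd; simp [Real.one_le_exp_iff]
  have hdpos : (0 : ℝ) < d := by exact_mod_cast hd
  have h1 : 1 + 1 / (d : ℝ) ≤ Real.exp (1 / (d : ℝ)) := by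
    have := Real.add_one_le_exp (1 / (d : ℝ)); linarith
  have h0 : 0 ≤ 1 + 1 / (d : ℝ) := by positivity
  calc (1 + 1 / (d : ℝ)) ^ d ≤ (Real.exp (1 / (d : ℝ))) ^ d := pow_le_pow_left₀ h0 h1 d
    _ = Real.exp 1 := by rw [← Real.exp_nat_mul]; congr 1; field_simp

/-- ★ `e^{−1/2} ≤ (1 + 1/d)^{−d/2}`: with `θ = 1/d_F` the follower block of `lintegral_prod_gaussian_block_ge` loses at most `√e`. [folklore] -/
theorem exp_neg_half_le_one_add_inv_rpow (d : ℕ) : Real.exp (-(1 / 2 : ℝ)) ≤ (1 + 1 / (d : ℝ)) ^ (-((d : ℝ) / 2)) := by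
  have h0 : 0 < 1 + 1 / (d : ℝ) := by positivity
  have h := one_add_inv_pow_le_exp_one d
  -- (1+1/d)^(-(d/2)) = ((1+1/d)^d)^(-1/2) ≥ (e)^(-1/2)
  have hrw : (1 + 1 / (d : ℝ)) ^ (-((d : ℝ) / 2)) = ((1 + 1 / (d : ℝ)) ^ d) ^ (-(1 / 2 : ℝ)) := by
    rw [← Real.rpow_natCast, ← Real.rpow_mul h0.le]; congr 1; ring
  rw [hrw, show Real.exp (-(1 / 2 : ℝ)) = (Real.exp 1) ^ (-(1 / 2 : ℝ)) by rw [Real.exp_one_rpow]]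
  exact Real.rpow_le_rpow_of_nonpos (pow_pos h0 d) h (by norm_num)

end Summit.QuantumFields.YangMills.Theorems.SwapVirialDeficit.SectorLaplace

end
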